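import Literature.NumberTheory.EllipticCurves.Rank1Residual.CornerFTwoCertificates.Claim
import HarnessLib

/-!
# The CM corner at `p = 2` in analytic rank one (leaf `CornerF @ 2`) — certificate records of the QUADRATIC-TWIST print families (Shu–Zhai 2021 at the CM bases `256c1`, `36a1`, `144a1`): the record schema, its in-kernel recheck, and what a certified record decodes to

HONEST FRAMING (cell `bsd-print-cf2`, run/shared/lean/pub/bsd-print-cf2/, D-0131 (2) PRINT TIER, seat
ty3; verbatim): PARTITION currency only — the leaf `CornerF @ 2` (`W/ℚ` with complex multiplication,
analytic rank `1`, the prime `2`) counts when its class theorem is in the kernel BY NAME; Literature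
named facts are statement-only with cite tags; every imported theorem carries its printed hypotheses
verbatim. The leaf is OPEN AS A CLASS. Companion of `Schema.lean` / `Claim.lean` (the records of the
`E_n` and cube-sum families) for the THREE QUADRATIC-TWIST FAMILIES that print closes BY NAME at `2`
through Shu–Zhai 2021 Thm. 1.2 (ranks) and Thm. 1.4 (the `2`-part of BSD), typed in the tree as
`ShuZhai2021.thm12_ranks_of_twists` / `thm14_twoPartBSD_of_twists` and specialised to explicit
congruence families by the cell's provers (`Summit.….P2.ShuZhai{TwoFiftySix,ThirtySix,OneFortyFour}Slices`,
theorems `analyticRank_eq_one_and_bsdp_two_of_twist_curve…_explicit`):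

* `shuZhai256` — base `E₀ = 256c1 : y² = x³ + 2x` (`j = 1728`, CM by `ℤ[i]`, `2` RAMIFIED), members
  `E₀^{(−pM)} : y² = x³ + 2p²M²x` with `p ≡ 7 (mod 8)` prime, `M = ∏_{q ∈ Q} q`, `Q` a finite set of
  primes `≡ 5 (mod 8)` of EVEN cardinality. [cite: ShuZhai2021, Thm. 1.2, Thm. 1.4 and Thm. 1.6 (1)]
* `shuZhai36` — base `36a1 : y² = x³ + 1` (`j = 0`, CM by `ℤ[ζ₃]`, `2` INERT), members
  `36a1^{(−pM)} : y² = x³ + 3pM x² + 3p²M² x ≅ y² = x³ − (pM)³` with `p ≡ 23 (mod 24)` prime, `Q` a finite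
  set of primes `≡ 5 (mod 12)` with `M = ∏ q ≡ 1 (mod 24)`. [cite: ShuZhai2021, Thm. 1.2, Thm. 1.4 and §5.2 Table (row 36a1)]
* `shuZhai144` — base `144a1 : y² = x³ − 1` (`j = 0`, `2` INERT), members
  `144a1^{(−pM)} : y² = x³ − 3pM x² + 3p²M² x ≅ y² = x³ + (pM)³`, same `(p, Q)`. [cite: ShuZhai2021, Thm. 1.2 and Thm. 1.4]

For every member print gives `ord_{s=1} L = rank = 1` and `BSD(E, 2)` (hence the leaf pair is CLOSED BY
NAME on these families, member by member, once the six displayed facts of the provers' theorems are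
granted), and Thm. 4.10 gives UNCONDITIONALLY `Ш` finite of odd order and `L′(E,1) = x·Ω·R` with
`ord₂ x = #Q`. [cite: ShuZhai2021, Thm. 4.10]

## What a record records, and what the kernel rechecks (`TwistRecord.check`, decidable)

* `p`, `qs` (the primes of `Q`, increasing), `param = p · ∏ qs` (the twist is by `−param`). RECHECKED:
  primality (trial division `< 504100`, the tree's `isPrimeBelow504100`), `qs` duplicate-free, the
  family's residue conditions (`p % 8 = 7`, `q % 8 = 5`, `#Q` even; resp. `p % 24 = 23`, `q % 12 = 5`,
  `∏ q % 24 = 1`) and `param = p · ∏ qs` — EXACTLY the hypotheses `hp`, `h8`/`h24`, `hQ`, `heven`/`hM` of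
  the provers' `_explicit` theorems, so a certified record is a member BY NAME (`TwistRecord.hyps256_of_check`,
  `TwistRecord.hyps36_of_check` below; the Summit-side display glue feeds them to those theorems).
* `ainvs` = the a-invariants of the TREE model `curveX.quadraticTwist (−param)` (`[0,0,0,2n²,0]`,
  `[0,3n,0,3n²,0]`, `[0,−3n,0,3n²,0]`; all three are global minimal models: `P2.isGloballyMinimal_quadraticTwist_curve256c1`,
  `P2.isGloballyMinimal_twist36`, and the `144a1` analogue of the display glue), `conductor` (`256n²`,
  `36n²`, `144n²`: the twisting character `(−n/·)`, `−n ≡ 1 (mod 8)` resp. `(mod 24)`-compatible, is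
  unramified at `2` and `3`), `cmDisc` (`−4` resp. `−3`). RECHECKED as identities of the record's fields.
* `rankMW`, `rankAn`, `rootNumber`, `torsion`, `tamagawa`, `sel2` (`#Sel₂ = 2^{dim E[2] + sel2}` from
  `2`-descent), `shaAn` (analytic order of `Ш`, an integer agreed by the engines to `digits` digits),
  `ord2ShaAn`, `sha2` (`dim Ш[2]` from descent), `ord2LOmegaR` (`v₂` of `L′(E,1)/(Ω·R) = ∏c·#Ш_an/#tor²`),
  `engines`: the TWO-ENGINE numeric columns (P = PARI/GP: `ellanalyticrank`, `ellrank`, `ellheegner`,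
  `ellheight`, `ellbsd`; S = SageMath: `lseries().deriv_at1`, `period_lattice`, eclib two-descent,
  `height(algorithm = "sage")`; kit jobs named per record). RECHECKED for consistency only:
  `rankAn = rankMW = 1`, `rootNumber = −1` (the leaf), `shaAn` a positive square, `ord2ShaAn = v₂(shaAn)`,
  `sel2 = rankMW + sha2`, `v₂(∏c · shaAn) = ord2LOmegaR + 2·v₂(#tor)`, two engines, `digits ≥ 1`; AGAINST
  PRINT: `sha2 = 0` and `ord2ShaAn = 0` (`Ш` odd, Thm. 4.10 / BSD(E,2)) and `ord2LOmegaR = #Q` (Thm. 4.10).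

NOT checked here (CLAIMS about the curve): the ranks, `#Ш_an`, the Selmer group — the numeric columns
are evidence; `BSD(E,2)` itself comes BY NAME from print (Summit-side glue
`Summit.BirchSwinnertonDyer.Rank1Residual.P2.CornerFTwoCertificatesShuZhai`), not from the numbers.

## Design

Plain computable data; `decide` (kernel) runs the recheck; no `instance` is declared (`TwistCertified`
is an `abbrev` of a `Bool` equation); no `native_decide`; kernel arithmetic REUSED from the tree's
`X11RankOneCertificates.Schema` (`isPrimeBelow504100`, `natVal`) and list plumbing from `Claim.lean`.
References: [ShuZhai2021] Thm. 1.2, 1.4, 1.6, 4.10, §5.2 Table; [Cremona1997] Table 1 (36A1, 144A1,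
256C1); [Miller2011LMS] Def. 1.1; HOME/STATUS.md (ty3 g2 lines); kit jobs j288708 (P), j288712 (S).
-/

open Literature.NumberTheory.EllipticCurves.Rank1Residual.X11RankOneCertificates
  (natVal isPrimeBelow504100 prime_of_isPrimeBelow504100)

namespace Literature.NumberTheory.EllipticCurves.Rank1Residual.CornerFTwoCertificates

/-- The quadratic-twist print families of the leaf `CornerF @ 2` a twist record may belong to (module
docstring, §families): Shu–Zhai 2021 Thm. 1.2 / 1.4 at the CM bases `256c1`, `36a1`, `144a1`.
[cite: ShuZhai2021, Thm. 1.2, Thm. 1.4 and §5.2 Table] -/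
inductive TwistFamily
  /-- `256c1^{(−pM)} : y² = x³ + 2p²M²x`, `p ≡ 7 (mod 8)`, `Q ⊂ {q ≡ 5 (mod 8)}`, `#Q` even (`2` ramified in `ℚ(i)`). -/
  | shuZhai256
  /-- `36a1^{(−pM)} ≅ y² = x³ − (pM)³`, `p ≡ 23 (mod 24)`, `Q ⊂ {q ≡ 5 (mod 12)}`, `M ≡ 1 (mod 24)` (`2` inert in `ℚ(√−3)`). -/
  | shuZhai36
  /-- `144a1^{(−pM)} ≅ y² = x³ + (pM)³`, same `(p, Q)` (`2` inert in `ℚ(√−3)`). -/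
  | shuZhai144
  deriving DecidableEq, Repr

/-- The base conductor `N(E₀)` of the family: `256`, `36`, `144`. [cite: Cremona1997, Table 1 (256C1, 36A1, 144A1)] -/
def TwistFamily.baseConductor : TwistFamily → ℕ
  | .shuZhai256 => 256
  | .shuZhai36 => 36
  | .shuZhai144 => 144

/-- The CM discriminant of the family: `−4` (`ℚ(i)`, `2` ramified) for `256c1`, `−3` (`ℚ(√−3)`, `2`
inert) for `36a1` / `144a1`. [cite: ShuZhai2021, Thm. 1.6 (1) and §5.2] -/
def TwistFamily.cmDisc : TwistFamily → ℤ
  | .shuZhai256 => -4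
  | _ => -3

/-- The a-invariants of the TREE model of the member with parameter `n` (the twist by `−n`):
`curve256c1.quadraticTwist (−n) = [0,0,0,2n²,0]`, `curve36a1.quadraticTwist (−n) = [0,3n,0,3n²,0]`,
`curve144a1.quadraticTwist (−n) = [0,−3n,0,3n²,0]` (tree lemmas `P2.quadraticTwist_curve256c1`,
`P2.quadraticTwist_curve36a1_neg`, `P2.quadraticTwist_curve144a1`). [cite: SilvermanAEC2009, X.5 Cor. 5.4] -/
def TwistFamily.model : TwistFamily → ℕ → List ℤ
  | .shuZhai256, n => [0, 0, 0, 2 * (n : ℤ) ^ 2, 0]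
  | .shuZhai36, n => [0, 3 * (n : ℤ), 0, 3 * (n : ℤ) ^ 2, 0]
  | .shuZhai144, n => [0, -(3 * (n : ℤ)), 0, 3 * (n : ℤ) ^ 2, 0]

/-- One certificate record of a quadratic-twist family of the leaf `CornerF @ 2`: the DATA of one member
(see the module docstring for the meaning of each field). A record asserts nothing by itself;
`TwistRecord.check` is its decidable recheck. [cite: ShuZhai2021, Thm. 1.2 and Thm. 1.4 (hypotheses)]
[cite: Miller2011LMS, Def. 1.1] -/
structure TwistRecord where
  /-- the print family. -/
  family : TwistFamily
  /-- the distinguished prime `p` (`≡ 7 (mod 8)` resp. `≡ 23 (mod 24)`). -/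
  p : ℕ
  /-- the primes of the admissible set `Q` (increasing); `M = ∏ qs`. -/
  qs : List ℕ
  /-- the twisting parameter `n = p · M` (the member is the twist of the base by `−n`). -/
  param : ℕ
  /-- LMFDB / Cremona label of the member when inside a database range (documentation; `""` otherwise). -/
  label : String
  /-- a-invariants `[a₁,a₂,a₃,a₄,a₆]` of the TREE model `curveX.quadraticTwist (−n)` (a global minimal model). -/
  ainvs : List ℤ
  /-- the conductor. -/
  conductor : ℕ
  /-- the CM discriminant `d_K` (`−4` or `−3`). -/
  cmDisc : ℤ
  /-- Mordell–Weil rank (engines). -/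
  rankMW : ℕ
  /-- analytic rank (engines). -/
  rankAn : ℕ
  /-- global root number (engines). -/
  rootNumber : ℤ
  /-- `#E(ℚ)_tors`. -/
  torsion : ℕ
  /-- Tamagawa product `∏_ℓ c_ℓ`. -/
  tamagawa : ℕ
  /-- `s` with `#Sel₂(E/ℚ) = 2^{dim E(ℚ)[2] + s}` from `2`-descent (`= rank + dim Ш[2]`). -/
  sel2 : ℕ
  /-- the analytic order of `Ш`, rounded (engines agree to `digits` digits that it is this integer). -/
  shaAn : ℕ
  /-- `v₂(shaAn)`. -/
  ord2ShaAn : ℕ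
  /-- `dim_{𝔽₂} Ш(E)[2]` from `2`-descent (`= sel2 − rankMW`). -/
  sha2 : ℕ
  /-- `v₂(L′(E,1)/(Ω·R))` as computed (`= v₂(∏c · #Ш_an / #tor²)`); print: `= #Q` (Shu–Zhai Thm. 4.10). -/
  ord2LOmegaR : ℕ
  /-- decimal digits to which the engines agree on `#Ш_an` (min over engines). -/
  digits : ℕ
  /-- provenance strings (engine:job); at least two. -/
  engines : List String
  deriving DecidableEq

namespace TwistRecord

variable (r : TwistRecord)

/-- Support: `p` and every `q` are prime (`< 504100`) and `qs` is duplicate-free.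
[cite: ShuZhai2021, Thm. 1.2 (hypotheses: p, q₁, …, q_r distinct primes)] -/
def checkPrimes : Bool :=
  isPrimeBelow504100 r.p && r.qs.all isPrimeBelow504100 && decide r.qs.Nodup

/-- The family's congruences and the shape of the parameter: `param = p · ∏ qs`;
`shuZhai256`: `p % 8 = 7`, every `q % 8 = 5`, `#qs` even; `shuZhai36` / `shuZhai144`: `p % 24 = 23`,
every `q % 12 = 5`, `(∏ qs) % 24 = 1` — the binders of the provers' `_explicit` theorems.
[cite: ShuZhai2021, Thm. 1.2, Def. 1.1 and §5.2 Table (rows 36a1; base 256c1 by (2.3)/Prop. 2.4)] -/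
def checkShape : Bool :=
  (r.param == r.p * r.qs.prod) &&
  match r.family with
  | .shuZhai256 => (r.p % 8 == 7) && (r.qs.all fun q => q % 8 == 5) && (r.qs.length % 2 == 0)
  | .shuZhai36 | .shuZhai144 =>
    (r.p % 24 == 23) && (r.qs.all fun q => q % 12 == 5) && (r.qs.prod % 24 == 1)

/-- Model, conductor, CM discriminant: `ainvs` = the tree model of the family at `param`,
`conductor = N(E₀) · param²`, `cmDisc` = the family's. [cite: ShuZhai2021, Thm. 1.6 (1) and §5.2]
[cite: SilvermanAEC2009, X.5 Cor. 5.4] -/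
def checkModel : Bool :=
  (r.ainvs == r.family.model r.param) && (r.conductor == r.family.baseConductor * r.param ^ 2) &&
    (r.cmDisc == r.family.cmDisc)

/-- Invariants and the two-engine columns, consistency only: the LEAF (`rankAn = rankMW = 1`,
`rootNumber = −1`), `0 < shaAn` a perfect square, `ord2ShaAn = v₂(shaAn)`, `sel2 = rankMW + sha2`,
`0 < torsion`, `0 < tamagawa`, `v₂(∏c · shaAn) = ord2LOmegaR + 2·v₂(#tor)`, `1 ≤ digits`, at least two
engines. [cite: Miller2011LMS, Def. 1.1] -/
def checkInvariants : Bool :=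
  (r.rankAn == 1) && (r.rankMW == 1) && (r.rootNumber == -1) && decide (0 < r.shaAn) &&
  (Nat.sqrt r.shaAn * Nat.sqrt r.shaAn == r.shaAn) && (r.ord2ShaAn == natVal 2 r.shaAn) &&
  (r.sel2 == r.rankMW + r.sha2) && decide (0 < r.torsion) && decide (0 < r.tamagawa) &&
  (natVal 2 (r.tamagawa * r.shaAn) == r.ord2LOmegaR + 2 * natVal 2 r.torsion) &&
  decide (1 ≤ r.digits) && decide (2 ≤ r.engines.length)

/-- AGAINST PRINT (Shu–Zhai Thm. 4.10 on the member, and BSD(E,2) from Thm. 1.4): `Ш` has odd order, so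
`sha2 = 0` and `ord2ShaAn = 0`; and `ord₂(L′(E,1)/(Ω·R)) = #Q`, so `ord2LOmegaR = #qs`.
[cite: ShuZhai2021, Thm. 4.10 and Thm. 1.4] -/
def checkPrint : Bool :=
  (r.sha2 == 0) && (r.ord2ShaAn == 0) && (r.ord2LOmegaR == r.qs.length)

/-- The full recheck of a twist record (conjunction of the five checks above). [folklore] -/
def check : Bool :=
  r.checkPrimes && r.checkShape && r.checkModel && r.checkInvariants && r.checkPrint

end TwistRecord

/-- A list of twist records is `TwistCertified` when every one passes `TwistRecord.check`; the statement
of each display theorem `theorem certified… : TwistCertified [ … ] := by decide` of the files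
`RecordsShuZhai*.lean`. An `abbrev` of a `Bool` equation (no instance declared). [cite: Miller2011LMS, §1 and Def. 1.1] -/
abbrev TwistCertified (rs : List TwistRecord) : Prop := rs.all TwistRecord.check = true

/-- Unpacking `TwistCertified`: every listed record passes the recheck. [cite: Miller2011LMS, §1 and Def. 1.1] -/
theorem TwistCertified.check_of_mem {rs : List TwistRecord} (h : TwistCertified rs) {r : TwistRecord}
    (hr : r ∈ rs) : r.check = true :=
  List.all_eq_true.1 h r hr

/-! ### Decoding a certified twist record: the printed hypotheses, in the binder shapes of the provers' theorems -/

namespace TwistRecord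

variable (r : TwistRecord)

/-- Projection of a passing recheck: the prime check holds. [cite: ShuZhai2021, Thm. 1.2 (hypotheses)] -/
private theorem checkPrimes_of_check (h : r.check = true) : r.checkPrimes = true := by
  simp only [check, Bool.and_eq_true] at h; exact h.1.1.1.1

/-- Projection: the shape check holds. [cite: ShuZhai2021, Thm. 1.2 (hypotheses)] -/
private theorem checkShape_of_check (h : r.check = true) : r.checkShape = true := by
  simp only [check, Bool.and_eq_true] at h; exact h.1.1.1.2

/-- Projection: the model check holds. [cite: SilvermanAEC2009, X.5 Cor. 5.4] -/
private theorem checkModel_of_check (h : r.check = true) : r.checkModel = true := by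
  simp only [check, Bool.and_eq_true] at h; exact h.1.1.2

/-- Projection: the invariants check holds. [cite: Miller2011LMS, Def. 1.1] -/
private theorem checkInvariants_of_check (h : r.check = true) : r.checkInvariants = true := by
  simp only [check, Bool.and_eq_true] at h; exact h.1.2

/-- Projection: the print-consistency check holds. [cite: ShuZhai2021, Thm. 4.10] -/
private theorem checkPrint_of_check (h : r.check = true) : r.checkPrint = true := by
  simp only [check, Bool.and_eq_true] at h; exact h.2

/-- A passing record's `p` is prime, its `qs` are prime and distinct. [cite: ShuZhai2021, Thm. 1.2 (hypotheses)] -/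
theorem primes_of_check (h : r.check = true) : r.p.Prime ∧ (∀ q ∈ r.qs, q.Prime) ∧ r.qs.Nodup := by
  have h' := r.checkPrimes_of_check h
  simp only [checkPrimes, Bool.and_eq_true, decide_eq_true_eq] at h'
  exact ⟨prime_of_isPrimeBelow504100 h'.1.1, fun q hq => prime_of_all_isPrime h'.1.2 hq, h'.2⟩

/-- A passing record's parameter is `p · ∏ qs`. [cite: ShuZhai2021, Thm. 1.2 (the twist by −pM)] -/
theorem param_eq_of_check (h : r.check = true) : r.param = r.p * r.qs.prod := by
  have h' := r.checkShape_of_check h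
  simp only [checkShape, Bool.and_eq_true, beq_iff_eq] at h'
  exact h'.1

/-- For a duplicate-free list, the `Finset` product over `toFinset` is the list product. [folklore] -/
private theorem prod_toFinset_eq_prod {l : List ℕ} (hl : l.Nodup) : ∏ q ∈ l.toFinset, q = l.prod := by
  rw [List.prod_toFinset _ hl, List.map_id']

/-- For a duplicate-free list, `#toFinset = length`. [folklore] -/
private theorem card_toFinset_eq_length {l : List ℕ} (hl : l.Nodup) : l.toFinset.card = l.length :=
  List.toFinset_card_of_nodup hl

/-- **`shuZhai256` decoded** — exactly the binders `hp`, `h8`, `hQ`, `heven` of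
`P2.analyticRank_eq_one_and_bsdp_two_quadraticTwist_curve256c1` with `Q := r.qs.toFinset`, and the
parameter identity `p · ∏_{q ∈ Q} q = param`. [cite: ShuZhai2021, Thm. 1.2, Thm. 1.4 and Thm. 1.6 (1)] -/
theorem hyps256_of_check (h : r.check = true) (hf : r.family = .shuZhai256) :
    r.p.Prime ∧ r.p % 8 = 7 ∧ (∀ q ∈ r.qs.toFinset, q.Prime ∧ q % 8 = 5) ∧ r.qs.toFinset.card % 2 = 0 ∧
      r.p * ∏ q ∈ r.qs.toFinset, q = r.param := by
  obtain ⟨hp, hq, hnd⟩ := r.primes_of_check h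
  have h' := r.checkShape_of_check h
  rw [checkShape, hf] at h'
  simp only [Bool.and_eq_true, beq_iff_eq, List.all_eq_true] at h'
  obtain ⟨hparam, ⟨h8, hq8⟩, heven⟩ := h'
  refine ⟨hp, h8, fun q hq' => ?_, ?_, ?_⟩
  · exact ⟨hq q (List.mem_toFinset.1 hq'), hq8 q (List.mem_toFinset.1 hq')⟩
  · rw [card_toFinset_eq_length hnd]; exact heven
  · rw [prod_toFinset_eq_prod hnd]; exact hparam.symm

/-- **`shuZhai36` / `shuZhai144` decoded** — exactly the binders `hp`, `h24`, `hQ`, `hM` of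
`P2.analyticRank_eq_one_and_bsdp_two_of_twist_curve36a1_explicit` /
`P2.analyticRank_eq_one_and_bsdp_two_of_twist_curve144a1_explicit` with `Q := r.qs.toFinset`, and the
parameter identity. [cite: ShuZhai2021, Thm. 1.2, Thm. 1.4, Def. 1.1 and §5.2 Table (row 36a1)] -/
theorem hyps36_of_check (h : r.check = true) (hf : r.family = .shuZhai36 ∨ r.family = .shuZhai144) :
    r.p.Prime ∧ r.p % 24 = 23 ∧ (∀ q ∈ r.qs.toFinset, q.Prime ∧ q % 12 = 5) ∧
      (∏ q ∈ r.qs.toFinset, q) % 24 = 1 ∧ r.p * ∏ q ∈ r.qs.toFinset, q = r.param := by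
  obtain ⟨hp, hq, hnd⟩ := r.primes_of_check h
  have h' := r.checkShape_of_check h
  have h'' : (r.param == r.p * r.qs.prod) = true ∧ ((r.p % 24 == 23) &&
      (r.qs.all fun q => q % 12 == 5) && (r.qs.prod % 24 == 1)) = true := by
    rcases hf with hf | hf <;> rw [checkShape, hf] at h' <;> simpa only [Bool.and_eq_true] using h'
  simp only [Bool.and_eq_true, beq_iff_eq, List.all_eq_true] at h''
  obtain ⟨hparam, ⟨h24, hq12⟩, hM⟩ := h''
  refine ⟨hp, h24, fun q hq' => ?_, ?_, ?_⟩
  · exact ⟨hq q (List.mem_toFinset.1 hq'), hq12 q (List.mem_toFinset.1 hq')⟩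
  · rw [prod_toFinset_eq_prod hnd]; exact hM
  · rw [prod_toFinset_eq_prod hnd]; exact hparam.symm

/-- The parameter of a passing record is nonzero (a product of primes). [cite: ShuZhai2021, Thm. 1.2 (pM ≠ 0)] -/
theorem param_ne_zero_of_check (h : r.check = true) : r.param ≠ 0 := by
  obtain ⟨hp, hq, -⟩ := r.primes_of_check h
  rw [r.param_eq_of_check h]
  exact mul_ne_zero hp.ne_zero (List.prod_ne_zero fun h0 => (hq 0 h0).ne_zero rfl)

/-- The model of a passing record is the tree model of its family at `param`. [cite: SilvermanAEC2009, X.5 Cor. 5.4] -/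
theorem ainvs_eq_of_check (h : r.check = true) : r.ainvs = r.family.model r.param := by
  have h' := r.checkModel_of_check h
  simp only [checkModel, Bool.and_eq_true, beq_iff_eq] at h'
  exact h'.1.1

/-- The numeric columns of a passing record: a LEAF record (`rankAn = 1`, `rankMW = 1`, `rootNumber = −1`)
consistent with print (`sha2 = 0`, `ord2ShaAn = 0`, `ord2LOmegaR = #qs`, the claimed `#Ш_an` odd).
[cite: ShuZhai2021, Thm. 4.10] [cite: Miller2011LMS, Def. 1.1] -/
theorem numeric_of_check (h : r.check = true) :
    (r.rankAn = 1 ∧ r.rankMW = 1 ∧ r.rootNumber = -1) ∧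
      r.sha2 = 0 ∧ r.ord2ShaAn = 0 ∧ r.ord2LOmegaR = r.qs.length ∧ ¬ 2 ∣ r.shaAn := by
  have h' := r.checkPrint_of_check h
  simp only [checkPrint, Bool.and_eq_true, beq_iff_eq] at h'
  have hi := r.checkInvariants_of_check h
  simp only [checkInvariants, Bool.and_eq_true, beq_iff_eq, decide_eq_true_eq] at hi
  have hpos : 0 < r.shaAn := hi.1.1.1.1.1.1.1.1.2
  have hval : r.ord2ShaAn = natVal 2 r.shaAn := hi.1.1.1.1.1.1.2
  exact ⟨⟨hi.1.1.1.1.1.1.1.1.1.1.1, hi.1.1.1.1.1.1.1.1.1.1.2, hi.1.1.1.1.1.1.1.1.1.2⟩, h'.1.1, h'.1.2, h'.2,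
    not_two_dvd_of_natVal_eq_zero hpos (by rw [← hval, h'.1.2])⟩

end TwistRecord

/-! ### Sample and tamper test

The numeric columns of the sample are those of the display file `RecordsShuZhaiTwoFiftySix.lean`
(engines P = PARI/GP, S = SageMath; kit jobs named there). -/

/-- SAMPLE (and regression test of the recheck): the record of the first `shuZhai256` member
`256c1^{(−7)} : y² = x³ + 98x` (`p = 7 ≡ 7 (mod 8)`, `Q = ∅`; `N = 256·7² = 12544`; rank `= r_an = 1`,
`#E(ℚ)_tors = 2`, `∏ c_ℓ = 4`, `#Ш_an = 1`, `v₂(L′/(ΩR)) = v₂(4·1/2²) = 0 = #Q`) passes.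
[cite: ShuZhai2021, Thm. 1.2 and Thm. 1.4 (r = 0, base 256c1)] -/
theorem twistCertified_sample : TwistCertified [
  { family := .shuZhai256, p := 7, qs := [], param := 7, label := "", ainvs := [0, 0, 0, 98, 0],
    conductor := 12544, cmDisc := -4, rankMW := 1, rankAn := 1, rootNumber := -1, torsion := 2,
    tamagawa := 4, sel2 := 1, shaAn := 1, ord2ShaAn := 0, sha2 := 0, ord2LOmegaR := 0, digits := 10,
    engines := ["P:PARI j288708", "S:SageMath j288712"] } ] := by
  decide +kernel

/-- Tampering is caught: the same record with `qs := [5]`, `param := 35` (an ODD number of primes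
`≡ 5 (mod 8)` — not a member of the even-cardinality family; Thm. 4.10 then predicts
`v₂(L′/(ΩR)) = 1 ≠ 0`) fails the recheck. [cite: ShuZhai2021, Thm. 1.2 (even r) and Thm. 4.10] -/
theorem not_twistCertified_tampered : ¬ TwistCertified [
  { family := .shuZhai256, p := 7, qs := [5], param := 35, label := "", ainvs := [0, 0, 0, 2450, 0],
    conductor := 313600, cmDisc := -4, rankMW := 1, rankAn := 1, rootNumber := -1, torsion := 2,
    tamagawa := 8, sel2 := 1, shaAn := 1, ord2ShaAn := 0, sha2 := 0, ord2LOmegaR := 0, digits := 10,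
    engines := ["P:PARI j288708", "S:SageMath j288712"] } ] := by
  decide +kernel

end Literature.NumberTheory.EllipticCurves.Rank1Residual.CornerFTwoCertificates
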